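import Mathlib
import Summits.MatrixMultiplication.MatrixMultiplication.Theses.LevelGradedCohnUmans
import Summits.MatrixMultiplication.MatrixMultiplication.Theorems.SnLevelDesigns.Negative.DeadCorners
import Summits.MatrixMultiplication.MatrixMultiplication.Theorems.LevelGradedCohnUmansSnLevelDesignsStubFirstRowHooks
import Summits.MatrixMultiplication.MatrixMultiplication.Theorems.LevelGradedCohnUmansSnLevelDesignsStubNearWallGlue

/-!
# `SnLevelDesigns` (stmt-MatrixMultiplication-7613), line `fixed-set-certificates`: stub `stub_transfer` — Γ-subexponential separated families give the crux

Crux `Summit.MatrixMultiplication.MatrixMultiplication.Theses.LevelGradedCohnUmans.SnLevelDesigns`; skeleton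
`Cruxes/SnLevelDesigns/Lines/fixed_set_certificates.lean` (4 registered stubs); this file proves the registered
stub `stub_transfer` verbatim (name + signature, tree-only vocabulary) and lands
`--supports stmt-MatrixMultiplication-7613`.

Statement (`WallTransfer` of the line, ε-bookkeeping glue): dimension decay (`f^μ ≤ e^{-c√k} √D_k(n)` on the
level window, `k ≥ k₁`, `n ≥ k²`) → a Γ-subexponential `k`-token separated family (for every `c > 0` and
arbitrarily large `k`, some `n ≥ k²` and `Sep n k X Y Z` with `e^{-c√k} √D_k(n) ≤ (|X||Y||Z|)^{1/3}`, where
`D_k(n) = ∑_{μ₁ ≥ n-k} (f^μ)²`) → `∀ ε > 0, ∃ n k X Y Z, Negative.At ε n k X Y Z` (which is `SnLevelDesigns`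
verbatim, `Negative.snLevelDesigns_iff`).

Proof: the FIRST hypothesis (dimension decay) is NOT used.  We feed `P := Negative.Sep` into the garnir
line's landed glue `stub_nearWallGlue stub_firstRowHooks`, whose NearWall hypothesis asks, for every `δ > 0`
and `k₀`, for `k ≥ k₀`, `3k ≤ n`, `P n k X Y Z` and `D_k(n)^{3/2} ≤ e^{δ√k} · |X||Y||Z|`, and whose
conclusion is literally `Sep ∧ budget < volPow`, i.e. `Negative.At`.  The NearWall hypothesis follows from
the second hypothesis at `c := δ/3`, `k₀' := max k₀ 3`: `3k ≤ k·k = k² ≤ n` for `k ≥ 3`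
(`tr_three_mul_le`), the real sum `∑ (f^ν : ℝ)^{(2:ℝ)}` is the cast of the natural sum `∑ (f^ν)²`
(`Real.rpow_two`, inline), and cubing `e^{-c√k} √D ≤ V^{1/3}` gives `D^{3/2} ≤ e^{3c√k} V` (`tr_cube`).
-/

set_option linter.dupNamespace false

namespace Summit.MatrixMultiplication.MatrixMultiplication.Theorems.SnLevelDesigns

open scoped BigOperators

open Literature.NumberTheory.DiophantineGeometry (numStandardTableaux)

/-- `3k ≤ n` once `3 ≤ k` and `k² ≤ n` (as `3k ≤ k·k = k²`). -/
theorem tr_three_mul_le {k n : ℕ} (h3 : 3 ≤ k) (hn : k ^ 2 ≤ n) : 3 * k ≤ n :=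
  calc 3 * k ≤ k * k := Nat.mul_le_mul_right k h3
    _ = k ^ 2 := (Nat.pow_two k).symm
    _ ≤ n := hn

/-- Cubing the Γ-wall: from `e^{-cs} √D ≤ V^{1/3}` (`D, V ≥ 0`) deduce `D^{3/2} ≤ e^{3cs} V`. -/
theorem tr_cube {c s D V : ℝ} (hD : 0 ≤ D) (hV : 0 ≤ V)
    (h : Real.exp (-(c * s)) * Real.sqrt D ≤ V ^ ((1 : ℝ) / 3)) :
    D ^ ((3 : ℝ) / 2) ≤ Real.exp (3 * c * s) * V := by
  have h0 : 0 ≤ Real.exp (-(c * s)) * Real.sqrt D := by positivity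
  have h3 := pow_le_pow_left₀ h0 h 3
  have hV3 : (V ^ ((1 : ℝ) / 3)) ^ 3 = V := by
    rw [← Real.rpow_natCast, ← Real.rpow_mul hV]
    norm_num
  have hD3 : Real.sqrt D ^ 3 = D ^ ((3 : ℝ) / 2) := by
    rw [Real.sqrt_eq_rpow, ← Real.rpow_natCast, ← Real.rpow_mul hD]
    norm_num
  have hE3 : Real.exp (-(c * s)) ^ 3 = Real.exp (-(3 * c * s)) := by
    rw [← Real.exp_nat_mul]
    congr 1
    push_cast
    ring
  rw [mul_pow, hV3, hD3, hE3] at h3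
  calc D ^ ((3 : ℝ) / 2) = Real.exp (3 * c * s) * (Real.exp (-(3 * c * s)) * D ^ ((3 : ℝ) / 2)) := by
        rw [← mul_assoc, ← Real.exp_add, add_neg_cancel, Real.exp_zero, one_mul]
    _ ≤ Real.exp (3 * c * s) * V := mul_le_mul_of_nonneg_left h3 (Real.exp_pos _).le

/-- **`stub_transfer`** (registered stub of crux stmt-MatrixMultiplication-7613, line `fixed-set-certificates`,
skeleton `Cruxes/SnLevelDesigns/Lines/fixed_set_certificates.lean`): `WallTransfer` in tree-only vocabulary —
dimension decay → Γ-subexponential `k`-token separated families (`e^{-c√k} √D_k(n) ≤ (|X||Y||Z|)^{1/3}` for every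
`c > 0`, `k → ∞`, `n ≥ k²`) → `∀ ε > 0, ∃ n k X Y Z, Negative.At ε n k X Y Z`.  The proof ignores the first
(dimension-decay) hypothesis: it feeds `P := Negative.Sep` into the garnir line's landed
`stub_nearWallGlue stub_firstRowHooks` (NearWall at `δ` from the family at `c := δ/3`, `k ≥ 3`, via `tr_cube`,
`Real.rpow_two`, `tr_three_mul_le`); its conclusion `Sep ∧ budget < volPow` is `Negative.At` by `unfold`. -/
theorem stub_transfer :
    (∃ c : ℝ, 0 < c ∧ ∃ k₁ : ℕ, ∀ k : ℕ, k₁ ≤ k → ∀ n : ℕ, k ^ 2 ≤ n → ∀ μ : Nat.Partition n,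
      n - k ≤ μ.parts.sup →
        (Literature.NumberTheory.DiophantineGeometry.numStandardTableaux μ : ℝ) ≤ Real.exp (-(c * Real.sqrt (k : ℝ))) *
          Real.sqrt (∑ ν : Nat.Partition n,
            if n - k ≤ ν.parts.sup then (Literature.NumberTheory.DiophantineGeometry.numStandardTableaux ν : ℝ) ^ (2 : ℝ) else 0)) →
    (∀ c : ℝ, 0 < c → ∀ k₀ : ℕ, ∃ k : ℕ, k₀ ≤ k ∧ ∃ n : ℕ, k ^ 2 ≤ n ∧
      ∃ X Y Z : Finset (Equiv.Perm (Fin n)), Summit.MatrixMultiplication.MatrixMultiplication.Theorems.SnLevelDesigns.Negative.Sep n k X Y Z ∧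
        Real.exp (-(c * Real.sqrt (k : ℝ))) *
            Real.sqrt (∑ ν : Nat.Partition n,
              if n - k ≤ ν.parts.sup then (Literature.NumberTheory.DiophantineGeometry.numStandardTableaux ν : ℝ) ^ (2 : ℝ) else 0) ≤
          ((X.card * Y.card * Z.card : ℕ) : ℝ) ^ ((1 : ℝ) / 3)) →
    ∀ ε : ℝ, 0 < ε → ∃ (n k : ℕ) (X Y Z : Finset (Equiv.Perm (Fin n))),
      Summit.MatrixMultiplication.MatrixMultiplication.Theorems.SnLevelDesigns.Negative.At ε n k X Y Z := by
  intro _hDD hΓ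
  -- the NearWall hypothesis of `stub_nearWallGlue` for `P := Negative.Sep`
  have hNW : ∀ δ : ℝ, 0 < δ → ∀ k₀ : ℕ, ∃ k : ℕ, k₀ ≤ k ∧ ∃ (n : ℕ) (X Y Z : Finset (Equiv.Perm (Fin n))),
      3 * k ≤ n ∧ Negative.Sep n k X Y Z ∧
        ((∑ μ : Nat.Partition n, if n - k ≤ μ.parts.sup then numStandardTableaux μ ^ 2 else 0 : ℕ) : ℝ) ^
            ((3 : ℝ) / 2) ≤
          Real.exp (δ * Real.sqrt (k : ℝ)) * ((X.card * Y.card * Z.card : ℕ) : ℝ) := by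
    intro δ hδ k₀
    obtain ⟨k, hk, n, hn, X, Y, Z, hsep, hwall⟩ := hΓ (δ / 3) (by positivity) (max k₀ 3)
    refine ⟨k, le_trans (le_max_left _ _) hk, n, X, Y, Z,
      tr_three_mul_le (le_trans (le_max_right _ _) hk) hn, hsep, ?_⟩
    -- the real level sum `∑ (f^ν : ℝ)^{(2:ℝ)}` is the cast of the natural one `∑ (f^ν)²`
    have hsum : (∑ ν : Nat.Partition n,
        if n - k ≤ ν.parts.sup then (numStandardTableaux ν : ℝ) ^ (2 : ℝ) else 0) =
        ((∑ ν : Nat.Partition n, if n - k ≤ ν.parts.sup then numStandardTableaux ν ^ 2 else 0 : ℕ) : ℝ) := by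
      rw [Nat.cast_sum]
      refine Finset.sum_congr rfl fun ν _ => ?_
      split_ifs
      · rw [Nat.cast_pow, Real.rpow_two]
      · rw [Nat.cast_zero]
    rw [hsum] at hwall
    have hcube := tr_cube (Nat.cast_nonneg _) (Nat.cast_nonneg _) hwall
    have h3 : 3 * (δ / 3) = δ := by ring
    rw [h3] at hcube
    exact hcube
  intro ε hε
  obtain ⟨n, k, X, Y, Z, hP, hlt⟩ := stub_nearWallGlue stub_firstRowHooks Negative.Sep hNW ε hε
  refine ⟨n, k, X, Y, Z, ?_⟩
  unfold Negative.At Negative.budget Negative.volPow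
  exact ⟨hP, hlt⟩

end Summit.MatrixMultiplication.MatrixMultiplication.Theorems.SnLevelDesigns
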